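import Mathlib
import Summits.ValiantsHypothesis.ValiantsHypothesis.Theorems.FifoMatchingNNLowDegreeCofactorHardCofactorBuysVertices
import Summits.ValiantsHypothesis.ValiantsHypothesis.Theorems.FifoMatchingNNLowDegreeCofactorHardStubCarveInterval
import Summits.ValiantsHypothesis.ValiantsHypothesis.Theorems.FifoMatchingNNLowDegreeCofactorHardSupportGenericExpBound
import Literature.Computability.AlgebraicComplexity.NestFreeMatchingPoly
import HarnessLib

/-!
# Route FifoMatching — crux `NNLinearDegreeCofactorHard` (stmt-ValiantsHypothesis-23918), line
# `internal_cofactor`: stub S2a `stub_longRunInternalHard` — a long defect-free run forces hardness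

Registered line `Cruxes/NNLinearDegreeCofactorHard/Lines/internal_cofactor.lean` (tenure g8,
2026-08-28) reduces the crux `NNLinearDegreeCofactorHard` (every nonzero cofactor `h ∈ ℝ≥0[x]` with
`a · deg h ≤ n` leaves the nest-free matching polynomial `NN_n` quasi-polynomially hard,
`2^((log₂ n + c)^c) < L₊(NN_n · h) + L₊(h)`) to three stubs: S1 `stub_topInternalComponent`, S2a (this
file) and S2b `stub_denseInternalHard`.  This file proves **S2a, verbatim**:

* `stub_longRunInternalHard` — for every `c` and all large `n`: if the complement of the vertex set
  `R ⊆ [2n]` contains a run `[s, s + G)` of `G := 2·((log₂ n + c)^c + log₂ n + 1)^6 + 12`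
  consecutive vertices, then every nonzero INTERNAL cofactor `p` on `R` (both endpoints of every arc
  of every monomial of `p` lie in `R`) has `2^((log₂ n + c)^c) < L₊(NN_n · p)`.

Proof — the landed freed-vertices engine of the closed rung `NNLowDegreeCofactorHard` (stmt-22993),
run on a GIVEN interval instead of a pigeonholed block:

1. FREE `R` (`exists_freed_of_internal`): the substitution `x_e ↦ 1` for every arc `e` touching `R`
   is free (`complexity_aeval_le_of_free`) and maps the internal cofactor `p` to the nonzero constant
   `η = Σ coeff p` (`aeval_eq_C_sum_coeff`, `sum_coeff_ne_zero`), so `q := (NN_n · p)[R-arcs := 1]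
   = NN_n^R · η` has the support of `NN_n^R` (`support_mul_C_of_ne_zero`) and `L₊(q) ≤ L₊(NN_n · p)`.
2. CARVE THE RUN (`exists_carved_of_run`): the carving data `(a, m) := (s + s mod 2, m)` with
   `2m + 1 ≤ G` is an even-offset interval inside the run, hence disjoint from `R`, and
   `Carve.Carving.exists_carved` yields `g` on `[2m]` with EXACTLY the support of `NN_m` and
   `L₊(g) ≤ L₊(q)`; here `m := ((log₂ n + c)^c + log₂ n + 1)^6 + 5`.
3. The support-generic thick-queue bound `exp_lower_bound_of_support_eq` (`2^{m^{1/6}} ≤ L₊(g)` for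
   `m ≥ n₁`) and the arithmetic of `nnDivisionHard_of_degree_budget`: for `n ≥ 2^{n₁}`,
   `m ≥ log₂ n + 1 > n₁` and `((log₂ n + c)^c + 1)^6 ≤ m`, so
   `2^((log₂ n + c)^c) < 2^((log₂ n + c)^c + 1) ≤ 2^{m^{1/6}} ≤ L₊(g) ≤ L₊(q) ≤ L₊(NN_n · p)`.

Honest framing: ONE registered stub (S2a, size M, no new combinatorics) of one line of an OPEN crux on
the conditional route `FifoMatching`; the crux closes only with S1 and the load-bearing S2b;
`NNDivisionHard`, `NNNotVP` and VP ≠ VNP are NOT proved, and monotone ≠ general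
(`Literature.Barriers.ValiantsHypothesis.MonotoneGap`).  No definitions, no named facts.
-/

noncomputable section

-- Sub = Summit single-conjunct layout: the duplicated namespace component is mandated by the tree.
set_option linter.dupNamespace false

namespace Summit.ValiantsHypothesis.ValiantsHypothesis.Theorems.FifoMatching.NNLinearDegreeCofactorHard

open MvPolynomial Literature.Computability.AlgebraicComplexity
open Summit.ValiantsHypothesis.ValiantsHypothesis.Theorems.FifoMatching.NNLowDegreeCofactorHard
open Summit.ValiantsHypothesis.ValiantsHypothesis.Theorems.ZeroOneTransfer.Negative
open scoped NNReal

/-! ### 1. Freeing the vertex set of an internal cofactor -/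

/-- **Freeing `R` for an internal cofactor.**  If every arc of every monomial of the nonzero
`p ∈ ℝ≥0[x_(i,j)]` has both endpoints in `R`, then `q := (NN_n · p)[x_e := 1, e touching R]` has the
support of `NN_n^R := NN_n[x_e := 1, e touching R]` and `L₊(q) ≤ L₊(NN_n · p)` (the substitution is a
projection and `p ↦ Σ coeff p ≠ 0`). [folklore] -/
theorem exists_freed_of_internal (n : ℕ) (R : Finset (Fin (2 * n)))
    (p : MvPolynomial (Fin (2 * n) × Fin (2 * n)) ℝ≥0) (hp : p ≠ 0)
    (hint : ∀ d ∈ p.support, ∀ e ∈ d.support, e.1 ∈ R ∧ e.2 ∈ R) :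
    ∃ q : MvPolynomial (Fin (2 * n) × Fin (2 * n)) ℝ≥0,
      q.support = (MvPolynomial.aeval (fun e : Fin (2 * n) × Fin (2 * n) =>
          if e.1 ∈ R ∨ e.2 ∈ R then (1 : MvPolynomial (Fin (2 * n) × Fin (2 * n)) ℝ≥0)
          else MvPolynomial.X e) (nestFreeMatchingPoly n ℝ≥0)).support ∧
      complexity q ≤ complexity (nestFreeMatchingPoly n ℝ≥0 * p) := by
  have hη : (∑ d ∈ p.support, coeff d p) ≠ 0 := sum_coeff_ne_zero hp
  refine ⟨MvPolynomial.aeval (fun e : Fin (2 * n) × Fin (2 * n) =>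
      if e.1 ∈ R ∨ e.2 ∈ R then (1 : MvPolynomial (Fin (2 * n) × Fin (2 * n)) ℝ≥0)
      else MvPolynomial.X e) (nestFreeMatchingPoly n ℝ≥0 * p), ?_, ?_⟩
  · -- support: the internal cofactor becomes a nonzero constant
    have hφ : MvPolynomial.aeval (fun e : Fin (2 * n) × Fin (2 * n) =>
        if e.1 ∈ R ∨ e.2 ∈ R then (1 : MvPolynomial (Fin (2 * n) × Fin (2 * n)) ℝ≥0)
        else MvPolynomial.X e) p = C (∑ d ∈ p.support, coeff d p) :=
      aeval_eq_C_sum_coeff _ fun d hd e he => if_pos (Or.inl (hint d hd e he).1)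
    rw [map_mul, hφ, support_mul_C_of_ne_zero _ hη]
  · -- complexity: every substituted input is `1` or a variable
    have hfree : ∀ e : Fin (2 * n) × Fin (2 * n), complexity
        (if e.1 ∈ R ∨ e.2 ∈ R then (1 : MvPolynomial (Fin (2 * n) × Fin (2 * n)) ℝ≥0)
          else MvPolynomial.X e) = 0 := by
      intro e
      by_cases he : e.1 ∈ R ∨ e.2 ∈ R
      · rw [if_pos he, ← C_1]; exact complexity_C_holds _
      · rw [if_neg he]; exact complexity_X_holds _
    exact complexity_aeval_le_of_free _ hfree _

/-! ### 2. Carving a given run -/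

/-- **Carving a GIVEN run.**  If the run `[s, s + L) ⊆ [2n]` misses `R` and `2m + 1 ≤ L`, `0 < m`,
then for every `q` with the support of `NN_n^R` there is `g` in the arc variables of `[2m]` with
EXACTLY the support of `NN_m` and `L₊(g) ≤ L₊(q)`: carve the even-offset interval
`[s + s mod 2, s + s mod 2 + 2m)` of the run (`Carve.Carving.exists_carved`). [folklore] -/
theorem exists_carved_of_run {n : ℕ} (R : Finset (Fin (2 * n))) {s L m : ℕ}
    (hL : s + L ≤ 2 * n) (hrun : ∀ j : Fin (2 * n), s ≤ j.val → j.val < s + L → j ∉ R)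
    (hm : 0 < m) (hmL : 2 * m + 1 ≤ L)
    (q : MvPolynomial (Fin (2 * n) × Fin (2 * n)) ℝ≥0)
    (hq : q.support = (MvPolynomial.aeval (fun e : Fin (2 * n) × Fin (2 * n) =>
        if e.1 ∈ R ∨ e.2 ∈ R then (1 : MvPolynomial (Fin (2 * n) × Fin (2 * n)) ℝ≥0)
        else MvPolynomial.X e) (nestFreeMatchingPoly n ℝ≥0)).support) :
    ∃ g : MvPolynomial (Fin (2 * m) × Fin (2 * m)) ℝ≥0,
      g.support = (nestFreeMatchingPoly m ℝ≥0).support ∧ complexity g ≤ complexity q := by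
  have hle : s + s % 2 + 2 * m ≤ 2 * n := by omega
  have heven : (s + s % 2) % 2 = 0 := by omega
  let Cv : FreedVertices.Carve.Carving n := ⟨s + s % 2, m, hle, hm, heven⟩
  have hR : ∀ i ∈ Cv.I, i ∉ R := by
    intro i hi
    obtain ⟨h1, h2⟩ := Cv.mem_I.1 hi
    change s + s % 2 ≤ (i : ℕ) at h1
    change (i : ℕ) < s + s % 2 + 2 * m at h2
    exact hrun i (by omega) (by omega)
  exact Cv.exists_carved hR q hq

/-! ### 3. The stub -/

/-- **Stub S2a of line `internal_cofactor` (crux `NNLinearDegreeCofactorHard`,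
stmt-ValiantsHypothesis-23918), verbatim: a long defect-free run forces hardness.**  For every `c`
there is `n₀` such that for all `n ≥ n₀` and every vertex set `R ⊆ [2n]` whose complement contains a
run of `2·((log₂ n + c)^c + log₂ n + 1)^6 + 12` consecutive vertices, every nonzero internal cofactor
`p` on `R` satisfies `2^((log₂ n + c)^c) < L₊(NN_n · p)`.  Proof: free `R`, carve the run at
half-length `m = ((log₂ n + c)^c + log₂ n + 1)^6 + 5`, apply the support-generic thick-queue bound
`2^{m^{1/6}} ≤ L₊(g)`; `n₀ = 2^{n₁}` for the threshold `n₁` of that bound. [folklore] -/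
theorem stub_longRunInternalHard :
    ∀ c : ℕ, ∃ n₀ : ℕ, ∀ n ≥ n₀, ∀ R : Finset (Fin (2 * n)),
      (∃ s : ℕ, s + (2 * ((Nat.log 2 n + c) ^ c + Nat.log 2 n + 1) ^ 6 + 12) ≤ 2 * n ∧
        ∀ j : Fin (2 * n), s ≤ j.val →
          j.val < s + (2 * ((Nat.log 2 n + c) ^ c + Nat.log 2 n + 1) ^ 6 + 12) → j ∉ R) →
      ∀ p : MvPolynomial (Fin (2 * n) × Fin (2 * n)) ℝ≥0, p ≠ 0 →
        (∀ d ∈ p.support, ∀ e ∈ d.support, e.1 ∈ R ∧ e.2 ∈ R) →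
          2 ^ ((Nat.log 2 n + c) ^ c) < complexity (nestFreeMatchingPoly n ℝ≥0 * p) := by
  intro c
  obtain ⟨n₁, hn₁⟩ := exp_lower_bound_of_support_eq
  refine ⟨2 ^ n₁, fun n hn R hrun p hp hint => ?_⟩
  obtain ⟨s, hs, hsR⟩ := hrun
  set k := Nat.log 2 n with hk
  set A := (k + c) ^ c with hA
  -- (1) free `R`
  obtain ⟨q, hq, hqc⟩ := exists_freed_of_internal n R p hp hint
  -- (2) carve the given run at half-length `m`
  set m := (A + k + 1) ^ 6 + 5 with hm
  have hmpos : 0 < m := by omega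
  have hmL : 2 * m + 1 ≤ 2 * (A + k + 1) ^ 6 + 12 := by omega
  obtain ⟨g, hg, hgc⟩ := exists_carved_of_run R hs hsR hmpos hmL q hq
  -- (3) `m ≥ n₁`: `k ≥ n₁` and `m ≥ (k+1)^6 ≥ k + 1`
  have hk₁ : n₁ ≤ k := Nat.le_log_of_pow_le (by norm_num) hn
  have hk6 : A + k + 1 ≤ (A + k + 1) ^ 6 := by
    calc A + k + 1 = (A + k + 1) ^ 1 := (pow_one _).symm
      _ ≤ (A + k + 1) ^ 6 := Nat.pow_le_pow_right (by omega) (by norm_num)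
  have hm₁ : n₁ ≤ m := by omega
  -- `A + 1 ≤ m^{1/6}`
  have hA6 : (A + 1) ^ 6 ≤ m :=
    (Nat.pow_le_pow_left (show A + 1 ≤ A + k + 1 by omega) 6).trans (by omega)
  have hroot : (((A + 1 : ℕ) : ℝ)) ≤ (m : ℝ) ^ ((1 : ℝ) / 6) := by
    have hcast : (((A + 1 : ℕ) : ℝ)) ^ 6 ≤ (m : ℝ) := by exact_mod_cast hA6
    have h := Real.rpow_le_rpow (by positivity) hcast (by norm_num : (0 : ℝ) ≤ 1 / 6)
    have h6 : ((((A + 1 : ℕ) : ℝ)) ^ 6) ^ ((1 : ℝ) / 6) = ((A + 1 : ℕ) : ℝ) := by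
      rw [show ((1 : ℝ) / 6) = ((6 : ℕ) : ℝ)⁻¹ by norm_num]
      exact Real.pow_rpow_inv_natCast (by positivity) (by norm_num)
    rw [h6] at h
    exact h
  -- the thick-queue bound for `g`
  have hmain := hn₁ m hm₁ g hg
  have hfinal : (((2 ^ (A + 1) : ℕ) : ℝ)) ≤ (complexity g : ℝ) := by
    calc (((2 ^ (A + 1) : ℕ) : ℝ)) = (2 : ℝ) ^ (((A + 1 : ℕ) : ℝ)) := by
          rw [Real.rpow_natCast]; push_cast; ring
      _ ≤ (2 : ℝ) ^ ((m : ℝ) ^ ((1 : ℝ) / 6)) :=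
          Real.rpow_le_rpow_of_exponent_le (by norm_num) hroot
      _ ≤ _ := hmain
  have hfinal' : 2 ^ (A + 1) ≤ complexity g := by exact_mod_cast hfinal
  calc 2 ^ ((Nat.log 2 n + c) ^ c) = 2 ^ A := by rw [hA]
    _ < 2 ^ (A + 1) := Nat.pow_lt_pow_right (by norm_num) (by omega)
    _ ≤ complexity g := hfinal'
    _ ≤ complexity q := hgc
    _ ≤ complexity (nestFreeMatchingPoly n ℝ≥0 * p) := hqc

end Summit.ValiantsHypothesis.ValiantsHypothesis.Theorems.FifoMatching.NNLinearDegreeCofactorHard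

end
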